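import Summits.HodgeConjecture.HodgeConjecture.Theorems.Ring2HypothesesDescentMotivatedOperators
import Literature.AlgebraicGeometry.HodgeTheory.GysinBaseChangeOfKunneth
import Literature.AlgebraicGeometry.HodgeTheory.MotivatedClassesAlgebraic
import HarnessLib

/-!
# Ring 2 hypotheses, descent face — correspondence CLASSES acting on ALL degrees at once: a degree-uniform
# Gysin base change, uniform composition of (motivated / algebraic) correspondence classes, uniform
# Lefschetz twists, and the diagonal class acting as the identity

research route conditional on HC_CM; not a corollary; Q11.4-sentence-2 already refuted in dim ≥ 3.
Cell `pub-hodge-ring2` (Hodge ladder STAGE 3), seat `ring2-b05` (binder row b05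
`Ring2.Hypotheses.MotivatedImpliesAlgebraicAV`), gen 36. `HC_CM` (`Theses.RankFourFaces.CMAbelianHodge`) does
not occur in this file; nothing here proves a case of the Hodge conjecture; the row b05 stays OPEN.

A HOMOGENEOUS class `γ ∈ H^{2e}((W ⊗ X)(ℂ); ℂ)` acts as `[γ]_* = corrAction μ hW hX hab γ : Hᵃ(X(ℂ)) → Hᵇ(W(ℂ))` in
EVERY degree `a` (`a + 2e = b + 2 dim X`). Statements about operators on the total cohomology `⊕_a Hᵃ` — the Künneth
projectors `π^a` («`id` on `Hᵃ`, `0` on the other degrees»), Kleiman's `Λ` — need ONE class whose action is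
prescribed in ALL degrees simultaneously; the per-degree tools of `…MotivatedOperators` and of ab-andre-2's XXII-b
produce a class PER DEGREE, because the tree's Gysin base change `gysin_baseChange` yields its scalar `c` degree by
degree. The scalar in its proof (`GysinBaseChangeOfKunneth`: `c = α β⁻¹`, the ratio of the two degree-`0` fibre
integrals) does not depend on the degree; this file records the uniform statement and its consequences:

* §1 `gysin_baseChange_uniform` — ONE `c` with `snd_{X,Y}^* (fst_{Y,Z})_* = c • (X ◁ fst_{Y,Z})_* snd^*` in every
  degree (proof = the tree's, with the degree quantifier moved inside; Fulton Prop. 1.7).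
* §2 `exists_corrCompClass_total` — for classes `γ` on `X ⊗ Y` and `γ'` on `Y ⊗ Z` there is ONE class `γ''` on
  `X ⊗ Z` (namely `c • p₁₃_*(p₁₂^* γ ∪ p₂₃^* γ')`) with `[γ'']_* = [γ]_* ∘ [γ']_*` in EVERY degree, motivated if `γ, γ'`
  are (gen 35's `corrCompClass_mem_motivatedClasses`) and algebraic if `γ, γ'` are (`corrCompClass_mem_algebraicClasses`
  with `Voisin2003_cupProduct_algebraicClasses_holds`).
* §3 `corrAction_cupProduct_snd_lefschetzOperator`, `exists_twistClass_total` — the right Lefschetz twist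
  `[pr_X^* ηʳ ∪ γ]_* = [γ]_* ∘ Lʳ_η` with ONE class in every degree.
* §4 `corrAction_diagonalClass` — the class of the diagonal `[Δ] = (𝟙, 𝟙)_* 1 ∈ Nⁿ H²ⁿ((X ⊗ X)(ℂ))` acts as the
  identity in every degree (the tree's `corrClassAction_graph` for `f = 𝟙`), and is algebraic, hence motivated.

No definition, no named fact, no sorry. References: Fulton1998 (Prop. 1.7, §16.1 Def. 16.1.1, Prop. 16.1.1),
FultonYoungTableaux1997 (App. B (2), (5), (6)), Kleiman1968AlgebraicCycles (§1.3–1.4), Andre1996Motifs (§2.1 p. 15),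
HatcherAT2002 (§3.2 Thm. 3.15, §3.3 Thm. 3.26).
-/

noncomputable section

-- every declaration of this problem lives in `Summit.HodgeConjecture.HodgeConjecture.…` (summit = sub-problem)
set_option linter.dupNamespace false

open CategoryTheory AlgebraicGeometry MonoidalCategory CartesianMonoidalCategory
open Literature.AlgebraicTopology.SingularHomology Literature.Geometry.Kaehler
open Literature.AlgebraicGeometry Literature.AlgebraicGeometry.Motives
  Literature.AlgebraicGeometry.HodgeTheory

namespace Summit.HodgeConjecture.HodgeConjecture.Theorems

variable (μ : OrientationFamily) {l m n : ℕ} {W X Y Z : SchemeOver ℂ}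

/-! ## §1 A degree-uniform Gysin base change -/

/-- **Gysin base change with ONE scalar for all degrees** (Fulton Prop. 1.7 for the cartesian square of projections
`X ⊗ (Y ⊗ Z) → Y ⊗ Z` over `X ⊗ Y → Y`): there is `c ∈ ℂ` with `snd_{X,Y}^*((fst_{Y,Z})_* z) = c • (X ◁ fst_{Y,Z})_*(snd^* z)`
for every degree `k` and every `z ∈ Hᵏ((Y ⊗ Z)(ℂ))`. The tree's `gysin_baseChange_of_kunneth` proves this degree by
degree with the degree-free scalar `c = α β⁻¹` (ratio of the degree-`0` fibre integrals `snd^* fst_* snd^* w₁` and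
`(X ◁ fst)_* snd^* snd^* w₁` of a top class `w₁` of `Z(ℂ)`); the proof below is that proof with the degree quantifier
inside (Künneth spanning `kunnethSpan_complexBetti`, vanishing below the fibre dimension, projection formula).
-- adapted from Literature/AlgebraicGeometry/HodgeTheory/GysinBaseChangeOfKunneth.lean (`gysin_baseChange_of_kunneth`)
[cite: Fulton1998, Prop. 1.7 and §16.1] [cite: FultonYoungTableaux1997, Appendix B §B.1 (5)–(6)] [cite: HatcherAT2002, §3.2 Thm. 3.15] -/
theorem gysin_baseChange_uniform (hX : IsSmoothProjective l X) (hY : IsSmoothProjective m Y)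
    (hZ : IsSmoothProjective n Z) :
    ∃ c : ℂ, ∀ {k k₁ : ℕ} (hk : k + 2 * m = k₁ + 2 * (m + n)) (z : complexBetti (Y ⊗ Z) k),
      complexBetti.map (snd X Y) k₁
        (complexGysin μ (IsSmoothProjective.tensor_holds hY hZ) hY (fst Y Z) hk z) =
      c • complexGysin μ
          (IsSmoothProjective.tensor_holds hX (IsSmoothProjective.tensor_holds hY hZ))
          (IsSmoothProjective.tensor_holds hX hY) (X ◁ fst Y Z)
          (show k + 2 * (l + m) = k₁ + 2 * (l + (m + n)) by omega)
          (complexBetti.map (snd X (Y ⊗ Z)) k z) := by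
  have hμ : μ.HasPoincareDuality := OrientationFamily.hasPoincareDuality μ
  have hYZ := IsSmoothProjective.tensor_holds hY hZ
  have hXY := IsSmoothProjective.tensor_holds hX hY
  have hT := IsSmoothProjective.tensor_holds hX hYZ
  -- the two degree-`0` fibre integrals `A w = snd^*(fst_* snd^* w)`, `B w = (X ◁ fst)_*(snd^* snd^* w)`
  let A : complexBetti Z (2 * n) →ₗ[ℂ] complexBetti (X ⊗ Y) 0 :=
    (complexBetti.map (snd X Y) 0).hom ∘ₗ
      complexGysin μ hYZ hY (fst Y Z) (show 2 * n + 2 * m = 0 + 2 * (m + n) by omega) ∘ₗ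
      (complexBetti.map (snd Y Z) (2 * n)).hom
  let B : complexBetti Z (2 * n) →ₗ[ℂ] complexBetti (X ⊗ Y) 0 :=
    complexGysin μ hT hXY (X ◁ fst Y Z) (show 2 * n + 2 * (l + m) = 0 + 2 * (l + (m + n)) by omega) ∘ₗ
      (complexBetti.map (snd X (Y ⊗ Z)) (2 * n)).hom ∘ₗ (complexBetti.map (snd Y Z) (2 * n)).hom
  obtain ⟨w₁, hw₁⟩ := exists_complexGysin_map_ne_zero μ hX hY hZ (kunnethSpan_complexBetti hX hYZ _)
    (kunnethSpan_complexBetti hY hZ _)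
  have hBw₁ : B w₁ ≠ 0 := hw₁
  have hw₁0 : w₁ ≠ 0 := by
    rintro rfl
    exact hBw₁ (map_zero B)
  obtain ⟨α, hα⟩ := exists_eq_smul_one μ hXY (A w₁)
  obtain ⟨β, hβ⟩ := exists_eq_smul_one μ hXY (B w₁)
  have hβ0 : β ≠ 0 := by
    rintro rfl
    exact hBw₁ (by rw [hβ, zero_smul])
  -- `A = (α β⁻¹) • B` on the line `H²ⁿ(Z(ℂ)) = ℂ · w₁`
  have hAB : ∀ w, A w = (α * β⁻¹) • B w := by
    intro w
    obtain ⟨t, rfl⟩ := exists_eq_smul_of_top μ hZ hw₁0 w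
    simp only [map_smul, hα, hβ, smul_smul]
    congr 1
    field_simp
  refine ⟨α * β⁻¹, fun {k k₁} hk z ↦ ?_⟩
  -- both sides are linear in `z`: check on cross products
  let F : complexBetti (Y ⊗ Z) k →ₗ[ℂ] complexBetti (X ⊗ Y) k₁ :=
    (complexBetti.map (snd X Y) k₁).hom ∘ₗ complexGysin μ hYZ hY (fst Y Z) hk
  let G : complexBetti (Y ⊗ Z) k →ₗ[ℂ] complexBetti (X ⊗ Y) k₁ :=
    (α * β⁻¹) • (complexGysin μ hT hXY (X ◁ fst Y Z)
      (show k + 2 * (l + m) = k₁ + 2 * (l + (m + n)) by omega) ∘ₗ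
      (complexBetti.map (snd X (Y ⊗ Z)) k).hom)
  change F z = G z
  refine LinearMap.eqOn_span (f := F) (g := G) ?_ (kunnethSpan_complexBetti hY hZ k z)
  rintro _ ⟨i, j, hij, b, w, rfl⟩
  change complexBetti.map (snd X Y) k₁ (complexGysin μ hYZ hY (fst Y Z) hk
      (cupProduct hij (complexBetti.map (fst Y Z) i b) (complexBetti.map (snd Y Z) j w))) =
    (α * β⁻¹) • complexGysin μ hT hXY (X ◁ fst Y Z) _ (complexBetti.map (snd X (Y ⊗ Z)) k
      (cupProduct hij (complexBetti.map (fst Y Z) i b) (complexBetti.map (snd Y Z) j w)))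
  -- `snd^*(fst^* b ∪ snd^* w) = (X ◁ fst)^* snd^* b ∪ snd^* snd^* w` on `X ⊗ (Y ⊗ Z)`
  have epull : complexBetti.map (snd X (Y ⊗ Z)) k
      (cupProduct hij (complexBetti.map (fst Y Z) i b) (complexBetti.map (snd Y Z) j w)) =
      cupProduct hij (complexBetti.map (X ◁ fst Y Z) i (complexBetti.map (snd X Y) i b))
        (complexBetti.map (snd X (Y ⊗ Z)) j (complexBetti.map (snd Y Z) j w)) := by
    rw [cupProduct_map, ← CategoryTheory.comp_apply (f := complexBetti.map (fst Y Z) i),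
      ← complexBetti.map_comp, ← whiskerLeft_snd, complexBetti.map_comp, CategoryTheory.comp_apply]
  rw [epull]
  rcases lt_trichotomy j (2 * n) with hj | hj | hj
  · -- below the fibre dimension both sides vanish
    rw [complexGysin_cup_map_eq_zero_of_lt hYZ hY (fst Y Z) hij hk (by omega) b,
      complexGysin_cup_map_eq_zero_of_lt hT hXY (X ◁ fst Y Z) hij _ (by omega), map_zero, smul_zero]
  swap
  · haveI := subsingleton_complexBetti hZ hj
    rw [Subsingleton.elim w 0, map_zero, map_zero, map_zero, map_zero, map_zero, map_zero, map_zero,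
      smul_zero]
  subst hj
  obtain rfl : i = k₁ := by omega
  -- projection formula on both sides
  rw [complexGysin_cup hμ hYZ hY (fst Y Z) hij hk (show 2 * n + 2 * m = 0 + 2 * (m + n) by omega)
      (Nat.add_zero _) b, cupProduct_map,
    complexGysin_cup hμ hT hXY (X ◁ fst Y Z) hij _
      (show 2 * n + 2 * (l + m) = 0 + 2 * (l + (m + n)) by omega) (Nat.add_zero _)]
  change cupProduct _ (complexBetti.map (snd X Y) i b) (A w) =
    (α * β⁻¹) • cupProduct _ (complexBetti.map (snd X Y) i b) (B w)
  rw [hAB w, map_smul]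

/-! ## §2 Composition with ONE class in every degree -/

/-- **Uniform composition of correspondence classes.** For smooth projective `X, Y, Z` (dimensions `l, m, n`) and
classes `γ ∈ H^{2e}((X ⊗ Y)(ℂ))`, `γ' ∈ H^{2e'}((Y ⊗ Z)(ℂ))`, `e + e' = e'' + m`, there is ONE class
`γ'' ∈ H^{2e''}((X ⊗ Z)(ℂ))` — `c • p₁₃_*(p₁₂^* γ ∪ p₂₃^* γ')` with the uniform scalar of §1 — such that
`[γ'']_* = [γ]_* ∘ [γ']_*` on `Hᵃ(Z(ℂ))` for EVERY degree `a` (Fulton Def. 16.1.1 / Prop. 16.1.1, the tree's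
`corr_comp_of_baseChange`); `γ''` is MOTIVATED when `γ, γ'` are (André §2.1 Corollaire; gen 35's
`corrCompClass_mem_motivatedClasses`) and ALGEBRAIC when `γ, γ'` are (Buskin Lemma 6.3, `corrCompClass_mem_algebraicClasses`
with the tree theorem `Voisin2003_cupProduct_algebraicClasses_holds`). [cite: Fulton1998, §16.1 Def. 16.1.1 and Prop. 16.1.1]
[cite: Andre1996Motifs, §2.1 Corollaire (p. 15)] -/
theorem exists_corrCompClass_total (hX : IsSmoothProjective l X) (hY : IsSmoothProjective m Y)
    (hZ : IsSmoothProjective n Z) {e e' e'' : ℕ} (he : e + e' = e'' + m) (γ : complexBetti (X ⊗ Y) (2 * e))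
    (γ' : complexBetti (Y ⊗ Z) (2 * e')) :
    ∃ γ'' : complexBetti (X ⊗ Z) (2 * e''),
      (γ ∈ motivatedClasses (l + m) (X ⊗ Y) e → γ' ∈ motivatedClasses (m + n) (Y ⊗ Z) e' →
        γ'' ∈ motivatedClasses (l + n) (X ⊗ Z) e'') ∧
      (γ ∈ algebraicClasses (X ⊗ Y) e → γ' ∈ algebraicClasses (Y ⊗ Z) e' →
        γ'' ∈ algebraicClasses (X ⊗ Z) e'') ∧
      ∀ {a a₁ a₂ : ℕ} (h₁ : a + 2 * e' = a₁ + 2 * n) (h₂ : a₁ + 2 * e = a₂ + 2 * m)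
        (h₃ : a + 2 * e'' = a₂ + 2 * n),
        corrAction μ hX hZ h₃ γ'' = corrAction μ hX hY h₂ γ ∘ₗ corrAction μ hY hZ h₁ γ' := by
  have hμ : μ.HasPoincareDuality := OrientationFamily.hasPoincareDuality μ
  obtain ⟨c, hc⟩ := gysin_baseChange_uniform μ hX hY hZ
  have hT := IsSmoothProjective.tensor_holds hX (IsSmoothProjective.tensor_holds hY hZ)
  refine ⟨c • complexGysin μ hT (IsSmoothProjective.tensor_holds hX hZ) (X ◁ snd Y Z)
      (show 2 * (e + e') + 2 * (l + n) = 2 * e'' + 2 * (l + (m + n)) by omega)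
      (cupProduct ((Nat.mul_add 2 e e').symm : 2 * e + 2 * e' = 2 * (e + e'))
        (complexBetti.map (X ◁ fst Y Z) (2 * e) γ) (complexBetti.map (snd X (Y ⊗ Z)) (2 * e') γ')),
    fun hγ hγ' ↦ Submodule.smul_mem _ _ (corrCompClass_mem_motivatedClasses μ hX hY hZ he hγ hγ'),
    fun hγ hγ' ↦ Submodule.smul_mem _ _ (corrCompClass_mem_algebraicClasses hμ hX hY hZ he
      (fun a ha b hb ↦ Voisin2003_cupProduct_algebraicClasses_holds hT ha hb) hγ hγ'),
    fun {a a₁ a₂} h₁ h₂ h₃ ↦ ?_⟩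
  refine LinearMap.ext fun y ↦ ?_
  rw [LinearMap.comp_apply, corrAction_apply, corrAction_apply, corrAction_apply]
  exact corr_comp_of_baseChange hμ hX hY hZ h₁ h₂ (show 2 * e + 2 * e' = 2 * e'' + 2 * m by omega)
    ((Nat.mul_add 2 e e').symm) γ γ' c (fun z ↦ hc _ z) y

/-! ## §3 Right Lefschetz twists with ONE class in every degree -/

/-- **`[pr_X^* η ∪ γ]_* = [γ]_* ∘ L_η` in every degree** (the class-explicit form of `…MotivatedOperators`'
`comp_lefschetzOperator_mem_map_corrAction_motivatedClasses`): `pr_{W*}(pr_X^*(η ∪ x) ∪ γ) = pr_{W*}(pr_X^* x ∪ (pr_X^* η ∪ γ))`.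
[cite: VoisinHodgeII2003, proof of Thm. 10.17 (10.7)] [cite: HatcherAT2002, §3.2 Prop. 3.10 and Thm. 3.11] -/
theorem corrAction_cupProduct_snd_lefschetzOperator (hW : IsSmoothProjective m W) (hX : IsSmoothProjective n X)
    (η : complexBetti X 2) {e a₁ a₂ b : ℕ} (h12 : 2 + a₁ = a₂) (hab : a₂ + 2 * e = b + 2 * n)
    (hab₁ : a₁ + 2 * (e + 1) = b + 2 * n) (γ : complexBetti (W ⊗ X) (2 * e)) (x : complexBetti X a₁) :
    corrAction μ hW hX hab₁ (cupProduct (show 2 * 1 + 2 * e = 2 * (e + 1) by omega)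
        (complexBetti.map (snd W X) 2 η) γ) x =
      corrAction μ hW hX hab γ (lefschetzOperator η h12 x) := by
  have hWX := IsSmoothProjective.tensor_holds hW hX
  rw [corrAction_apply, corrAction_apply, lefschetzOperator_apply, complexBetti.map_cupProduct,
    cupProduct_gradedComm_holds ℂ _ h12 (show a₁ + 2 = a₂ by omega) (complexBetti.map (snd W X) 2 η)
      (complexBetti.map (snd W X) a₁ x)]
  have heven : ((-1 : ℂ) ^ (2 * a₁)) = 1 := by rw [pow_mul, neg_one_sq, one_pow]
  rw [heven, one_smul,
    cupProduct_assoc (show a₁ + 2 = a₂ by omega) (show 2 * 1 + 2 * e = 2 * (e + 1) by omega) rfl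
      (show a₁ + 2 * (e + 1) = a₂ + 2 * e by omega)]
  exact Ring2.AbelianAll.complexGysin_cupProduct_congr μ hWX hW (fst W X) rfl _ _ _ _ _

/-- **Uniform iterated right twist**: for `γ ∈ H^{2e}((W ⊗ X)(ℂ))` and `r` there is ONE class `γ_r` of codimension
`e + r` (namely `pr_X^* η ∪ (pr_X^* η ∪ ⋯ ∪ γ)`) with `[γ_r]_* = [γ]_* ∘ Lʳ_η` in EVERY degree; `γ_r` is motivated, resp.
algebraic, when `γ` is and `η ∈ N¹ H²(X(ℂ))` (an algebraic class times a motivated / algebraic class is motivated /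
algebraic: Prop. 2.1 (i) `cupProduct_mem_motivatedClasses_of_algebraic_left`, Voisin II Prop. 9.20
`Voisin2003_cupProduct_algebraicClasses_holds`). [cite: Andre1996Motifs, Prop. 2.1 (i) (p. 14)] [cite: VoisinHodgeII2003, §9.2.4 Prop. 9.20] -/
theorem exists_twistClass_total (hW : IsSmoothProjective m W) (hX : IsSmoothProjective n X) {η : complexBetti X 2}
    (hη : η ∈ algebraicClasses X 1) :
    ∀ (r : ℕ) {e e' : ℕ} (_ : e + r = e') (γ : complexBetti (W ⊗ X) (2 * e)),
      ∃ γ' : complexBetti (W ⊗ X) (2 * e'),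
        (γ ∈ motivatedClasses (m + n) (W ⊗ X) e → γ' ∈ motivatedClasses (m + n) (W ⊗ X) e') ∧
        (γ ∈ algebraicClasses (W ⊗ X) e → γ' ∈ algebraicClasses (W ⊗ X) e') ∧
        ∀ {a₁ a₂ b : ℕ} (h12 : a₁ + 2 * r = a₂) (hab : a₂ + 2 * e = b + 2 * n) (hab₁ : a₁ + 2 * e' = b + 2 * n),
          corrAction μ hW hX hab₁ γ' = corrAction μ hW hX hab γ ∘ₗ lefschetzPowTo η r a₁ a₂ h12
  | 0, e, e', he, γ => by
    obtain rfl : e = e' := by omega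
    refine ⟨γ, id, id, fun {a₁ a₂ b} h12 hab hab₁ ↦ ?_⟩
    obtain rfl : a₁ = a₂ := by omega
    rw [lefschetzPowTo_zero_eq_id, LinearMap.comp_id]
  | r + 1, e, e', he, γ => by
    have hWX := IsSmoothProjective.tensor_holds hW hX
    have hηWX : complexBetti.map (snd W X) 2 η ∈ algebraicClasses (W ⊗ X) 1 :=
      map_snd_mem_supportedClasses hW hX (a := 2 * 1) hη
    -- one twist: `γ₁ = pr_X^* η ∪ γ`, then `r` more
    obtain ⟨γ', hmot, halg, h'⟩ := exists_twistClass_total hW hX hη r (show e + 1 + r = e' by omega)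
      (cupProduct (show 2 * 1 + 2 * e = 2 * (e + 1) by omega) (complexBetti.map (snd W X) 2 η) γ)
    refine ⟨γ', fun hγ ↦ hmot (cupProduct_mem_motivatedClasses_of_algebraic_left hWX _ hηWX hγ),
      fun hγ ↦ halg ?_, fun {a₁ a₂ b} h12 hab hab₁ ↦ ?_⟩
    · have h := Voisin2003_cupProduct_algebraicClasses_holds hWX hηWX hγ
      exact (cupProduct_mem_supportedClasses_congr (two_mul_add_two_mul 1 e)
        (show 2 * 1 + 2 * e = 2 * (e + 1) by omega) (Nat.add_comm 1 e) _ _).1 h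
    · rw [h' rfl (show a₁ + 2 * r + 2 * (e + 1) = b + 2 * n by omega) hab₁]
      refine LinearMap.ext fun x ↦ ?_
      rw [LinearMap.comp_apply, LinearMap.comp_apply,
        corrAction_cupProduct_snd_lefschetzOperator μ hW hX η (show 2 + (a₁ + 2 * r) = a₂ by omega) hab
          (show a₁ + 2 * r + 2 * (e + 1) = b + 2 * n by omega) γ,
        lefschetzPowTo_succ_apply η r a₁ (a₁ + 2 * r) a₂ rfl h12 (by omega)]

/-! ## §4 The diagonal class acts as the identity in every degree -/

/-- **`[Δ]_* = id` on every `Hᵃ(X(ℂ); ℂ)`**, where `[Δ] = (𝟙, 𝟙)_* 1 ∈ H²ⁿ((X ⊗ X)(ℂ))` is the class of the diagonal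
(the graph of `𝟙 X`; the tree's `corrClassAction_graph`), and `[Δ]` is an algebraic, hence motivated, class of
codimension `n`. [cite: Andre1996Motifs, §2.1 (p. 15)] [cite: FultonYoungTableaux1997, Appendix B §B.1 (2), (5), (6)] -/
theorem corrAction_diagonalClass (hX : IsSmoothProjective n X) (a : ℕ) :
    complexGysin μ hX (IsSmoothProjective.tensor_holds hX hX) (lift (𝟙 X) (𝟙 X))
        (show 0 + 2 * (n + n) = 2 * n + 2 * n by omega) (singularCohomology.one ℂ (ComplexPoints X)) ∈
      algebraicClasses (X ⊗ X) n ∧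
    corrAction μ hX hX (rfl : a + 2 * n = a + 2 * n)
        (complexGysin μ hX (IsSmoothProjective.tensor_holds hX hX) (lift (𝟙 X) (𝟙 X))
          (show 0 + 2 * (n + n) = 2 * n + 2 * n by omega) (singularCohomology.one ℂ (ComplexPoints X))) =
      LinearMap.id := by
  have hμ : μ.HasPoincareDuality := OrientationFamily.hasPoincareDuality μ
  have hXX := IsSmoothProjective.tensor_holds hX hX
  refine ⟨complexGysin_graph_one_mem_algebraicClasses μ hμ hX hXX (𝟙 X), ?_⟩
  by_cases ha : a ≤ 2 * n
  · obtain ⟨q, hq⟩ : ∃ q, a + q = 2 * n := ⟨2 * n - a, by omega⟩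
    rw [corrAction_eq_corrClassAction μ hX hX rfl hq]
    refine LinearMap.ext fun c ↦ ?_
    rw [corrClassAction_graph μ hμ hX hXX (𝟙 X) hq c, complexBetti.map_id, LinearMap.id_apply]
    rfl
  · haveI := subsingleton_complexBetti hX (show 2 * n < a by omega)
    exact LinearMap.ext fun c ↦ Subsingleton.elim _ _

end Summit.HodgeConjecture.HodgeConjecture.Theorems

end
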